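import Literature.Claims.NS.TongTon2020
import HarnessLib

/-!
# C41 `TongTon2020` — kernel facts for the NS-claims sweep (D-0090), refuter-8

Typed record: `Literature.Claims.NS.TongTon2020` (typist-12, p478067), M. Tong & D. Ton, *Smooth Global
Solution of the Navier–Stokes Equation*, arXiv:2001.11699v10 (2026), Lemma 4 p.9 (proof pp.9–15, decisive
line (30)–(31) p.14).

Kernel facts (sorry-free, standard axioms):

* `assumptionF_quad` — the local Hölder–Lipschitz assumption (F), (12) p.9, holds for `g(t,x) = x + x²` near
  `(t₀, x₀) = (0, 1)` (`δ = 1`, `L = 5`, `ϑ = 1`).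
* `not_Lemma4Abs` — Lemma 4 at the grain of its own proof is false: with `a = 1` (the contraction semigroup
  `e^{−t}`), `g(t,x) = x + x²`, `x₀ = 1`, a global solution would solve `u′ = u²`, `u(0) = 1` on `(0,∞)`,
  continuous on `[0,∞)`; then `u ≥ 1` (monotone), `1/u + t` has zero derivative on `(0,2)`, so by the mean
  value theorem `1/u(2) = −1 < 0` — impossible. (Local assumption (F) does not give global existence.)
* `not_Step_31Abs` — the identity of integrals (30) = (31) p.14 is false: `a = 0`, `h ≡ 1`, `t₀ = 0`,
  `t₁ = 1`, `t = 2` gives `2 = 1`.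

WHAT THIS IS NOT: not a claim about NS regularity or blow-up; not a claim about any author beyond the
typed locator.
-/

set_option linter.dupNamespace false

noncomputable section

open Set Filter
open scoped Topology

namespace Summit.NavierStokesRegularity.NavierStokesRegularity.Theorems.TongTon2020

/-! ## (30)–(31) p.14 -/

/-- **The decisive line (30) = (31) p.14 is false at the typed grain (C41).** `a = 0`, `h ≡ 1`, `t₀ = 0`,
`t₁ = 1`, `t = 2`: `∫₀² 1 = 2 ≠ 1 = ∫₀¹ 1`. Refutes `Literature.Claims.NS.TongTon2020.Step_31Abs`
[refuted-substantive: the Duhamel integral over `[t₀,t]` is not the fixed point's integral over `[t₀,t₁]`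
for `t > t₁`]. [folklore] -/
theorem not_Step_31Abs : ¬ Literature.Claims.NS.TongTon2020.Step_31Abs := by
  intro h
  have key := h 0 0 1 (fun _ => 1) le_rfl one_pos continuous_const 2 (by norm_num)
  simp at key

/-! ## Lemma 4 p.9 -/

/-- **Assumption (F), (12) p.9, holds for the quadratic nonlinearity** `g(t,x) = x + x²` near `(0, 1)`:
for `|xᵢ − 1| ≤ 1`, `|(x₁ + x₁²) − (x₂ + x₂²)| = |x₁ − x₂|·|1 + x₁ + x₂| ≤ 5|x₁ − x₂|`. [folklore] -/
theorem assumptionF_quad :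
    Literature.Claims.NS.TongTon2020.AssumptionF (fun _ x => x + x ^ 2) 0 1 := by
  refine ⟨1, 5, 1, one_pos, by norm_num, one_pos, le_rfl, ?_⟩
  intro t₁ t₂ x₁ x₂ _ _ hx₁ hx₂
  rw [abs_le] at hx₁ hx₂
  have hfac : (x₁ + x₁ ^ 2) - (x₂ + x₂ ^ 2) = (x₁ - x₂) * (1 + x₁ + x₂) := by ring
  rw [hfac, abs_mul, Real.rpow_one]
  have h5 : |1 + x₁ + x₂| ≤ 5 := by
    rw [abs_le]; constructor <;> linarith [hx₁.1, hx₁.2, hx₂.1, hx₂.2]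
  have ht : 0 ≤ |t₁ - t₂| := abs_nonneg _
  have hx : 0 ≤ |x₁ - x₂| := abs_nonneg _
  nlinarith [mul_le_mul_of_nonneg_left h5 hx]

/-- **Lemma 4 p.9 is false at the grain of its own proof (C41).** `a = 1`, `g(t,x) = x + x²`, `t₀ = 0`,
`x₀ = 1` satisfy the hypotheses (`assumptionF_quad`); a global solution `u` would satisfy `u′ = u²` on
`(0,∞)`, `u(0) = 1`, `u` continuous on `[0,∞)`. Then `u` is monotone on `[0,∞)` (`u′ ≥ 0`), so `u ≥ 1`;
`φ(t) = u(t)⁻¹ + t` is continuous on `[0,2]` with `φ′ = −u′/u² + 1 = 0` on `(0,2)`, hence `φ(2) = φ(0) = 1`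
by the mean value theorem, i.e. `u(2)⁻¹ = −1`, contradicting `u(2) ≥ 1`. Refutes
`Literature.Claims.NS.TongTon2020.Lemma4Abs` [refuted-substantive: the local assumption (F) of Pazy's
Theorem 6.3.1 yields local, not global, solutions — finite-time blow-up of `u′ = u²`]. [folklore] -/
theorem not_Lemma4Abs : ¬ Literature.Claims.NS.TongTon2020.Lemma4Abs := by
  intro h
  obtain ⟨u, hcont, hu0, hder⟩ := h 1 zero_le_one (fun _ x => x + x ^ 2) 0 1 assumptionF_quad
  -- the equation is u' = u²
  have hu' : ∀ t : ℝ, 0 < t → HasDerivAt u (u t ^ 2) t := by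
    intro t ht
    have := hder t ht
    convert this using 1
    ring
  -- u is monotone on [0, ∞), hence u ≥ 1 there
  have hmono : MonotoneOn u (Ici 0) := by
    apply monotoneOn_of_deriv_nonneg (convex_Ici 0) hcont
    · rw [interior_Ici]
      intro t ht
      exact (hu' t ht).differentiableAt.differentiableWithinAt
    · rw [interior_Ici]
      intro t ht
      rw [(hu' t ht).deriv]
      positivity
  have hge : ∀ t : ℝ, 0 ≤ t → 1 ≤ u t := by
    intro t ht
    have := hmono (self_mem_Ici (a := (0 : ℝ))) (mem_Ici.mpr ht) ht
    rwa [hu0] at this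
  have hne : ∀ t : ℝ, 0 ≤ t → u t ≠ 0 := fun t ht => by
    have := hge t ht; positivity
  -- φ = 1/u + id has zero derivative on (0, 2)
  have hφ' : ∀ t ∈ Ioo (0 : ℝ) 2, HasDerivAt (fun s => (u s)⁻¹ + s) ((fun _ => (0 : ℝ)) t) t := by
    intro t ht
    have h0 : u t ^ 2 ≠ 0 := pow_ne_zero 2 (hne t ht.1.le)
    have h1 := ((hu' t ht.1).inv (hne t ht.1.le)).add (hasDerivAt_id t)
    have hval : -(u t ^ 2) / u t ^ 2 + 1 = (fun _ => (0 : ℝ)) t := by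
      simp only [neg_div, div_self h0]; ring
    rw [hval] at h1
    exact h1
  have hφc : ContinuousOn (fun s => (u s)⁻¹ + s) (Icc 0 2) :=
    ((hcont.mono Icc_subset_Ici_self).inv₀ (fun t ht => hne t ht.1)).add continuousOn_id
  -- mean value theorem on [0, 2]
  obtain ⟨c, _, hc⟩ := exists_hasDerivAt_eq_slope (fun s => (u s)⁻¹ + s) (fun _ => (0 : ℝ))
    (by norm_num : (0 : ℝ) < 2) hφc hφ'
  have h2 : (u 2)⁻¹ + 2 - ((u 0)⁻¹ + 0) = 0 := by
    have := hc.symm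
    rw [div_eq_iff (by norm_num : (2 : ℝ) - 0 ≠ 0), zero_mul] at this
    exact this
  rw [hu0, inv_one, add_zero] at h2
  have hpos : 0 < (u 2)⁻¹ := inv_pos.mpr (lt_of_lt_of_le one_pos (hge 2 (by norm_num)))
  linarith

end Summit.NavierStokesRegularity.NavierStokesRegularity.Theorems.TongTon2020

end
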